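import Summits.Ventures.HSemireg.WalshParityGeneral

/-!
# Venture HSemireg — LEMMA P for every n, the «only if» half of «equality iff» completed: a design attaining the bound 2^{n−1} has
# EXACTLY ONE letter vector in EACH class of ONE parity family, none in the other family, and m(x)·i^{|x|} constant on its support

HONEST FRAMING. Part of the Lean index of the computation cell `pub-hsemireg` (Sunday typer seat p9, § g = 8; family B rows **B20-k** of
`target-g8/CENSUS.md` v1.274 `7744dc4867915f69`, words «LEMMA P bound 2^(n−1)» ∕ «LEMMA P, B20-4: minimum 8 at n = 4»). FINITE
GAUSSIAN-INTEGER ARITHMETIC ONLY, continuing `WalshParityGeneral.lean` (same vocabulary `Letter n`, `Sgn n`, `I`, `chi`, `wsign`, `wt`,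
`par`, `moment`, `S`; this file does not import `WalshParityGeneralSharp.lean`). No abelian variety, graph Γ_D, cycle, class or filler is
constructed; LEMMA W («class-completable ⟺ all mixed full moments vanish; W-alive ⟺ m̂(1,…,1) ≠ 0») stays the DICTIONARY — TEXT OF
RECORD, not a binder and not proved here; nothing here says that HC ∕ HC_CM ∕ HC_AV holds; no object is certified; no Literature fact is
declared.

TEXT OF RECORD (quoted, not interpreted). Source: t-20, `target-g8/FAMILY-B-G8-t20.md` v1.25 `987a3ee140325c40`, §2.2 LEMMA P, last
sentence: «α ≠ 0 ⇒ at least 2^{n−1} parity classes carry support ⇒ every (effective or signed) class-completable W-alive unit-graph design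
has ≥ 2^{n−1} graphs, with equality iff the support is one letter-vector in each class of one parity family with m(x)i^{|x|} constant —
for effective m: m constant and |x| in a fixed residue mod 4.»

WHAT THIS FILE PROVES (every `n ≥ 1`). **`shape_of_card_eq`**: let `m` be an integer design on (ℤ∕4)ⁿ whose 2ⁿ − 2 mixed moments vanish
and whose support has EXACTLY 2^{n−1} letter vectors; let `r ∈ {0, 1}` name the parity family chosen by `α = m̂(+,…,+)` (`r = 0` with
`Re α ≠ 0`, or `r = 1` with `Im α ≠ 0` — by `WalshParityN.re_eq_zero_or_im_eq_zero_of_card_eq` at most one of Re α, Im α is non-zero,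
and α ≠ 0 picks one). Then EVERY class `p` with `|p| ≡ r (mod 2)` contains EXACTLY ONE support letter, NO support letter lies in the
other family, and `2ⁿ·m(x)·i^{|x|}` is the SAME Gaussian integer for every support letter `x` — namely `2·Re α` (r = 0) or `2i·Im α`
(r = 1). Corollary `shape_of_card_eq_of_ne_zero`: the same conclusion from `α ≠ 0` and `#supp = 2^{n−1}`, with the family read off α.
This is the n-parametric form of `WalshParity.card_eq_eight_shape_even` (n = 4, even family only); together with
`WalshParityN.two_pow_le_card_support` (the bound), `re_eq_zero_or_im_eq_zero_of_card_eq` and `WalshParityGeneralSharp.lean`'s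
`moments_of_shape` (the «if» half) it types the whole last sentence of LEMMA P for every n ≥ 1 — except the gloss «for effective m:
m constant and |x| in a fixed residue mod 4», which is the evident reading of «m(x)i^{|x|} constant with m(x) > 0» and is not spelled out.

WHAT IS NOT HERE. LEMMA W; the cascade fillers; any member computation of t-20 §3.
-/

namespace Summit.Ventures.HSemireg.WalshParityN

open Finset

variable {n : ℕ}

/-- **«EQUALITY IFF», ONLY-IF HALF — THE SHAPE OF AN EXTREMAL SUPPORT (every n ≥ 1):** in a design with mixed moments zero and
support of size exactly `2^{n−1}`, if `Re α ≠ 0` (family `r = 0`) or `Im α ≠ 0` (family `r = 1`) then every class of the family `r`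
carries EXACTLY ONE support letter, no support letter lies outside the family, and `2ⁿ·m(x)·i^{|x|}` equals `2·Re α` (resp. `2i·Im α`)
for every support letter `x` («equality iff the support is one letter-vector in each class of one parity family with m(x)i^{|x|}
constant», §2.2). -/
theorem shape_of_card_eq (hn : 0 < n) (m : Letter n → ℤ) (hmixed : ∀ δ : Sgn n, δ ≠ 0 → δ ≠ 1 → moment m δ = 0)
    (r : ℕ) (hfam : (r = 0 ∧ (moment m 0).re ≠ 0) ∨ (r = 1 ∧ (moment m 0).im ≠ 0))
    (hcard : (Finset.univ.filter (fun x : Letter n => m x ≠ 0)).card = 2 ^ (n - 1)) :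
    (∀ p : Sgn n, (∑ k, (p k).val) % 2 = r →
        ((Finset.univ.filter (fun x : Letter n => m x ≠ 0)).filter (fun x => par x = p)).card = 1) ∧
      (∀ x : Letter n, m x ≠ 0 → (∑ k, (par x k).val) % 2 = r ∧
        (2 : GaussianInt) ^ n * ((m x : GaussianInt) * I ^ (wt x)) =
          if r = 0 then (⟨2 * (moment m 0).re, 0⟩ : GaussianInt) else ⟨0, 2 * (moment m 0).im⟩) := by
  obtain ⟨k, rfl⟩ : ∃ k, n = k + 1 := ⟨n - 1, by omega⟩
  rw [Nat.add_sub_cancel] at hcard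
  have hr2 : r < 2 := by rcases hfam with ⟨h, _⟩ | ⟨h, _⟩ <;> omega
  set supp := Finset.univ.filter (fun x : Letter (k + 1) => m x ≠ 0) with hsupp
  set F : Finset (Sgn (k + 1)) := Finset.univ.filter (fun p : Sgn (k + 1) => (∑ i, (p i).val) % 2 = r) with hF
  have hFcard : F.card = 2 ^ k := card_parityFamily k r hr2
  -- every class of the family carries support
  have hSne : ∀ p ∈ F, S m p ≠ 0 := by
    intro p hp
    have hp' : (∑ i, (p i).val) % 2 = r := (Finset.mem_filter.mp hp).2
    rcases hfam with ⟨h0, hre⟩ | ⟨h1, him⟩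
    · exact S_ne_zero_of_even (Nat.succ_pos k) m hmixed hre p (hp'.trans h0)
    · exact S_ne_zero_of_odd (Nat.succ_pos k) m hmixed him p (hp'.trans h1)
  have hnonempty : ∀ p ∈ F, 1 ≤ (supp.filter (fun x => par x = p)).card := by
    intro p hp
    obtain ⟨x, hx, hmx⟩ := exists_support_of_S_ne_zero m p (hSne p hp)
    exact Finset.card_pos.mpr ⟨x, Finset.mem_filter.mpr ⟨Finset.mem_filter.mpr ⟨Finset.mem_univ x, hmx⟩, hx⟩⟩
  -- the fibres of `par` over F are disjoint pieces of supp: Σ_{p ∈ F} #fibre ≤ #supp = 2^k = |F|, each ≥ 1 ⇒ each = 1, nothing else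
  have hdisj : ∀ p ∈ F, ∀ q ∈ F, p ≠ q →
      Disjoint (supp.filter (fun x => par x = p)) (supp.filter (fun x => par x = q)) := by
    intro p _ q _ hpq
    exact Finset.disjoint_filter.mpr (fun x _ hxp hxq => hpq (hxp.symm.trans hxq))
  have hsum_le : ∑ p ∈ F, (supp.filter (fun x => par x = p)).card ≤ supp.card := by
    rw [← Finset.card_biUnion hdisj]
    exact Finset.card_le_card (Finset.biUnion_subset.mpr (fun p _ => Finset.filter_subset _ _))
  have hfib : ∀ p ∈ F, (supp.filter (fun x => par x = p)).card = 1 := by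
    intro p hp
    by_contra hne
    have hge2 : 2 ≤ (supp.filter (fun x => par x = p)).card := by
      have := hnonempty p hp; omega
    have hrest : (F.erase p).card ≤ ∑ q ∈ F.erase p, (supp.filter (fun x => par x = q)).card := by
      rw [Finset.card_eq_sum_ones]
      exact Finset.sum_le_sum (fun q hq => hnonempty q (Finset.mem_of_mem_erase hq))
    have hsplit := Finset.add_sum_erase F (fun q => (supp.filter (fun x => par x = q)).card) hp
    beta_reduce at hsplit
    have hEr : (F.erase p).card = 2 ^ k - 1 := by rw [Finset.card_erase_of_mem hp, hFcard]
    have hpos : 1 ≤ 2 ^ k := Nat.one_le_two_pow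
    rw [hcard] at hsum_le
    omega
  have hsum_eq : ∑ p ∈ F, (supp.filter (fun x => par x = p)).card = 2 ^ k := by
    rw [Finset.sum_congr rfl hfib, ← Finset.card_eq_sum_ones, hFcard]
  refine ⟨fun p hp => hfib p (Finset.mem_filter.mpr ⟨Finset.mem_univ p, hp⟩), fun x hmx => ?_⟩
  -- a support letter outside the family would make #supp ≥ 2^k + 1
  have hxF : (∑ i, (par x i).val) % 2 = r := by
    by_contra hout
    have hxmem : x ∈ supp := Finset.mem_filter.mpr ⟨Finset.mem_univ x, hmx⟩
    have hxnot : x ∉ F.biUnion (fun p => supp.filter (fun y => par y = p)) := by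
      intro hx
      obtain ⟨p, hp, hxp⟩ := Finset.mem_biUnion.mp hx
      have hpx : par x = p := (Finset.mem_filter.mp hxp).2
      exact hout (hpx ▸ (Finset.mem_filter.mp hp).2)
    have hsub : insert x (F.biUnion (fun p => supp.filter (fun y => par y = p))) ⊆ supp :=
      Finset.insert_subset hxmem (Finset.biUnion_subset.mpr (fun p _ => Finset.filter_subset _ _))
    have hle := Finset.card_le_card hsub
    rw [Finset.card_insert_of_notMem hxnot, Finset.card_biUnion hdisj, hsum_eq, hcard] at hle
    omega
  refine ⟨hxF, ?_⟩
  -- m(x)·i^{|x|} = S_{par x} since x is the only support letter of its class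
  have hS : S m (par x) = (m x : GaussianInt) * I ^ (wt x) := by
    have hone := hfib (par x) (Finset.mem_filter.mpr ⟨Finset.mem_univ _, hxF⟩)
    obtain ⟨y, hy⟩ := Finset.card_eq_one.mp hone
    have hxin : x ∈ supp.filter (fun z => par z = par x) :=
      Finset.mem_filter.mpr ⟨Finset.mem_filter.mpr ⟨Finset.mem_univ x, hmx⟩, rfl⟩
    rw [hy, Finset.mem_singleton] at hxin
    simp only [S]
    rw [Finset.sum_eq_single x]
    · rw [if_pos rfl]
    · intro z _ hzx
      by_cases hz : par z = par x
      · rw [if_pos hz]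
        by_cases hmz : m z = 0
        · simp [hmz]
        · exfalso
          have hzin : z ∈ supp.filter (fun w => par w = par x) :=
            Finset.mem_filter.mpr ⟨Finset.mem_filter.mpr ⟨Finset.mem_univ z, hmz⟩, hz⟩
          rw [hy, Finset.mem_singleton] at hzin
          exact hzx (hzin.trans hxin.symm)
      · rw [if_neg hz]
    · intro h; exact absurd (Finset.mem_univ x) h
  have hparts := S_formula_parts (Nat.succ_pos k) m hmixed (par x)
  rw [hS, hxF] at hparts
  rcases hfam with ⟨h0, _⟩ | ⟨h1, _⟩
  · subst h0
    rw [if_pos rfl] at hparts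
    rw [if_pos rfl]
    exact hparts
  · subst h1
    rw [if_neg (by norm_num)] at hparts
    rw [if_neg (by norm_num)]
    exact hparts

/-- COROLLARY (the family read off α): with mixed moments zero, `α ≠ 0` and support of size exactly `2^{n−1}` (n ≥ 1), EITHER `Im α = 0`
and the support is one letter per EVEN class with `2ⁿ·m(x)·i^{|x|} = 2·Re α`, OR `Re α = 0` and the support is one letter per ODD
class with `2ⁿ·m(x)·i^{|x|} = 2i·Im α`. -/
theorem shape_of_card_eq_of_ne_zero (hn : 0 < n) (m : Letter n → ℤ) (hmixed : ∀ δ : Sgn n, δ ≠ 0 → δ ≠ 1 → moment m δ = 0)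
    (halive : moment m 0 ≠ 0) (hcard : (Finset.univ.filter (fun x : Letter n => m x ≠ 0)).card = 2 ^ (n - 1)) :
    ∃ r : ℕ, r < 2 ∧ ((r = 0 ∧ (moment m 0).im = 0) ∨ (r = 1 ∧ (moment m 0).re = 0)) ∧
      (∀ p : Sgn n, (∑ k, (p k).val) % 2 = r →
        ((Finset.univ.filter (fun x : Letter n => m x ≠ 0)).filter (fun x => par x = p)).card = 1) ∧
      (∀ x : Letter n, m x ≠ 0 → (∑ k, (par x k).val) % 2 = r ∧
        (2 : GaussianInt) ^ n * ((m x : GaussianInt) * I ^ (wt x)) =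
          if r = 0 then (⟨2 * (moment m 0).re, 0⟩ : GaussianInt) else ⟨0, 2 * (moment m 0).im⟩) := by
  have hri := re_eq_zero_or_im_eq_zero_of_card_eq hn m hmixed hcard
  have hparts : (moment m 0).re ≠ 0 ∨ (moment m 0).im ≠ 0 := by
    by_contra h
    push Not at h
    exact halive (Zsqrtd.ext h.1 h.2)
  rcases hparts with hre | him
  · have him : (moment m 0).im = 0 := hri.resolve_left hre
    obtain ⟨h1, h2⟩ := shape_of_card_eq hn m hmixed 0 (Or.inl ⟨rfl, hre⟩) hcard
    exact ⟨0, by norm_num, Or.inl ⟨rfl, him⟩, h1, h2⟩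
  · have hre : (moment m 0).re = 0 := hri.resolve_right him
    obtain ⟨h1, h2⟩ := shape_of_card_eq hn m hmixed 1 (Or.inr ⟨rfl, him⟩) hcard
    exact ⟨1, by norm_num, Or.inr ⟨rfl, hre⟩, h1, h2⟩

end Summit.Ventures.HSemireg.WalshParityN
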